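import Summits.Ventures.PercRepro.GenQSolidTriples
import Summits.Ventures.PercRepro.GenQFlatLatticeG
import Summits.Ventures.PercRepro.GenQFlatLatticeH

/-!
# PercRepro — the flat-lattice counting rows, part I: the cap on the `6`-subsets at rank `6` (night-4, gen 11)

The `6`-subsets of a rank-`6` set `G` have rank `6` (the spanning sets at level `n − 6`), `5` (`Σ_s SP_{s,6}`), `4`
(inside one solid each) or `3` (inside one plane each — a `6`-point plane).  Inside a solid trace `X` of `s` points,
the `6`-subsets of rank `3` are the `6`-point planes of `X`, at most `⌊C(s, 3)/16⌋` of them (a `6`-point plane carries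
`≥ 16` rank-`3` triples, disjoint across planes — the lane's `card_rank_three_triples_ge`,
`sum_planes_rank_three_triples_le`), so the rank-`4` ones number `≥ r₆(s) = C(s, 6) − ⌊C(s, 3)/16⌋`
(`r6`: `5, 25, 79, 203` at `s = 7 … 10`).  Hence

`Σ_m #Pc (n−6) m + Σ_s SP_{s,6} + Σ_s r₆(s)·NR 4 s + Σ_s C(s, 6)·NR 3 s ≤ C(n, 6)`   (`gd6_row`)

— the row (G-D) of the two-level profile LP at `q = 6`, `j = 6` (sheet §65 (b)).  Imports `GenQSolidTriples`,
`GenQFlatLatticeG`, `GenQFlatLatticeH`.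
-/
namespace PercRepro.Night4

open Finset ThmH SixFour GenQ PerFlat Star

variable {α : Type*} [DecidableEq α] {M : Matroid α} [M.Finite]

/-- `r₆(s) = C(s, 6) − ⌊C(s, 3)/16⌋` for `7 ≤ s ≤ 10`, else `0`. -/
def r6 (s : ℕ) : ℕ := if s = 7 then 5 else if s = 8 then 25 else if s = 9 then 79 else if s = 10 then 203 else 0

/-- A `6`-subset of a plane trace has rank exactly `3` (lines `≤ 3`). -/
theorem eRk_eq_three_of_six_subset_plane (hs : Simple M) (hline : ∀ L ∈ flatsQ M 2, L.card ≤ 3)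
    {G P A : Finset α} (hG : G ⊆ gr M) (hP : P ∈ flatsQ M 3) (hA : A ⊆ P ∩ G) (hA6 : A.card = 6) :
    M.eRk (A : Set α) = ((3 : ℕ) : ℕ∞) := by
  have hP' := mem_flatsQ.1 hP
  have hAG : A ⊆ G := hA.trans Finset.inter_subset_right
  have hle : M.eRk (A : Set α) ≤ ((3 : ℕ) : ℕ∞) := by
    rw [← hP'.2.2]
    exact M.eRk_mono (Finset.coe_subset.2 (hA.trans Finset.inter_subset_left))
  obtain ⟨a, ha⟩ := exists_eRk_eq_nat (M := M) A
  rw [ha] at hle ⊢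
  have ha3 : a ≤ 3 := by exact_mod_cast hle
  by_contra hne
  have ha2 : a ≤ 2 := by
    rcases Nat.lt_or_ge a 3 with h | h
    · omega
    · exfalso; exact hne (by rw [show a = 3 by omega])
  have hflat : clF M A ∈ flatsQ M a := by
    rw [mem_flatsQ, ← Finset.coe_subset, coe_clF, coe_gr]
    exact ⟨M.closure_subset_ground _, M.isFlat_closure _, by rw [M.eRk_closure_eq, ha]⟩
  have hAcl : A ⊆ clF M A := by
    intro y hy
    rw [mem_clF]
    refine M.subset_closure _ ?_ (Finset.mem_coe.2 hy)
    rw [← coe_gr M]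
    exact Finset.coe_subset.2 (hAG.trans hG)
  have hcard := Finset.card_le_card hAcl
  rcases Nat.lt_or_ge a 2 with h1 | h2
  · have := card_le_one_of_flatsQ_le_one hs (by omega : a ≤ 1) hflat
    omega
  · have ha2' : a = 2 := by omega
    rw [ha2'] at hflat
    have := hline _ hflat
    omega

/-- The `6`-subsets of rank `3` of a set `X` number at most `⌊C(|X|, 3)/16⌋`: each is a `6`-point plane trace
carrying `≥ 16` rank-`3` triples, disjoint across planes. -/
theorem card_rank_three_sixes_mul_sixteen_le (hs : Simple M) (hline : ∀ L ∈ flatsQ M 2, L.card ≤ 3)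
    (hplane : ∀ P ∈ flatsQ M 3, P.card ≤ 6) {X : Finset α} (hX : X ⊆ gr M) :
    16 * ((X.powersetCard 6).filter (fun A : Finset α => M.eRk (A : Set α) = ((3 : ℕ) : ℕ∞))).card
      ≤ X.card.choose 3 := by
  classical
  rw [card_rank_eq_eq_sum_flats hX 6 3]
  refine le_trans ?_ (sum_planes_rank_three_triples_le hX)
  rw [Finset.mul_sum]
  refine Finset.sum_le_sum (fun P hP => ?_)
  -- a plane trace with `< 6` points has no `6`-subset; with `6` points it has one, and `≥ 16` rank-`3` triples
  rcases Nat.lt_or_ge (P ∩ X).card 6 with hlt | hge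
  · have h0 : ((P ∩ X).powersetCard 6).filter (fun A : Finset α => M.eRk (A : Set α) = ((3 : ℕ) : ℕ∞)) = ∅ := by
      rw [Finset.filter_eq_empty_iff]
      intro A hA
      rw [Finset.mem_powersetCard] at hA
      have := Finset.card_le_card hA.1
      omega
    rw [h0, Finset.card_empty, mul_zero]
    exact Nat.zero_le _
  · have h6 : (P ∩ X).card = 6 :=
      le_antisymm ((Finset.card_le_card Finset.inter_subset_left).trans (hplane P hP)) hge
    have h1 : ((P ∩ X).powersetCard 6).filter (fun A : Finset α => M.eRk (A : Set α) = ((3 : ℕ) : ℕ∞)) ⊆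
        (P ∩ X).powersetCard 6 := Finset.filter_subset _ _
    have h2 := Finset.card_le_card h1
    rw [Finset.card_powersetCard, h6, Nat.choose_self] at h2
    have h3 := (card_rank_three_triples_ge hs hline (Finset.inter_subset_right.trans hX)).1 h6
    calc 16 * (((P ∩ X).powersetCard 6).filter (fun A : Finset α => M.eRk (A : Set α) = ((3 : ℕ) : ℕ∞))).card
        ≤ 16 * 1 := Nat.mul_le_mul_left _ h2
      _ ≤ (((P ∩ X).powersetCard 3).filter (fun T : Finset α => M.eRk (T : Set α) = 3)).card := by
          rw [mul_one]; exact h3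

/-- The rank-`4` `6`-subsets of a solid trace number at least `r₆(|F ∩ G|)`. -/
theorem card_rank_four_sixes_ge (hs : Simple M) (hline : ∀ L ∈ flatsQ M 2, L.card ≤ 3)
    (hplane : ∀ P ∈ flatsQ M 3, P.card ≤ 6) {G F : Finset α} (hG : G ⊆ gr M) (hF : F ∈ flatsQ M 4) :
    r6 (F ∩ G).card ≤
      (((F ∩ G).powersetCard 6).filter (fun A : Finset α => M.eRk (A : Set α) = ((4 : ℕ) : ℕ∞))).card := by
  classical
  have hXg : F ∩ G ⊆ gr M := Finset.inter_subset_right.trans hG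
  by_cases hs7 : 7 ≤ (F ∩ G).card ∧ (F ∩ G).card ≤ 10
  · -- every `6`-subset has rank `≤ 4` (inside `F`) and `≥ 3` (lines `≤ 3`): it is of rank `3` or `4`
    have hF' := mem_flatsQ.1 hF
    have hsplit : ((F ∩ G).powersetCard 6).card
        ≤ (((F ∩ G).powersetCard 6).filter (fun A : Finset α => M.eRk (A : Set α) = ((4 : ℕ) : ℕ∞))).card
          + (((F ∩ G).powersetCard 6).filter (fun A : Finset α => M.eRk (A : Set α) = ((3 : ℕ) : ℕ∞))).card := by
      rw [← Finset.card_union_of_disjoint (Finset.disjoint_filter.2 (fun A _ h4 h3 => by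
          rw [h4] at h3; exact absurd h3 (by decide)))]
      refine Finset.card_le_card (fun A hA => ?_)
      rw [Finset.mem_union, Finset.mem_filter, Finset.mem_filter]
      rw [Finset.mem_powersetCard] at hA
      have hle : M.eRk (A : Set α) ≤ ((4 : ℕ) : ℕ∞) := by
        rw [← hF'.2.2]
        exact M.eRk_mono (Finset.coe_subset.2 (hA.1.trans Finset.inter_subset_left))
      obtain ⟨a, ha⟩ := exists_eRk_eq_nat (M := M) A
      rw [ha] at hle
      have ha4 : a ≤ 4 := by exact_mod_cast hle
      -- rank `≥ 3`: a `6`-set of rank `≤ 2` lies in a line (`≤ 3` points)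
      have ha3 : 3 ≤ a := by
        by_contra hlt
        have hflat : clF M A ∈ flatsQ M a := by
          rw [mem_flatsQ, ← Finset.coe_subset, coe_clF, coe_gr]
          exact ⟨M.closure_subset_ground _, M.isFlat_closure _, by rw [M.eRk_closure_eq, ha]⟩
        have hAcl : A ⊆ clF M A := by
          intro y hy
          rw [mem_clF]
          refine M.subset_closure _ ?_ (Finset.mem_coe.2 hy)
          rw [← coe_gr M]
          exact Finset.coe_subset.2 (hA.1.trans (hXg))
        have hcard := Finset.card_le_card hAcl
        rcases Nat.lt_or_ge a 2 with h1 | h2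
        · have := card_le_one_of_flatsQ_le_one hs (by omega : a ≤ 1) hflat
          omega
        · have ha2' : a = 2 := by omega
          rw [ha2'] at hflat
          have := hline _ hflat
          omega
      rcases Nat.lt_or_ge a 4 with h | h
      · right; exact ⟨Finset.mem_powersetCard.2 hA, by rw [ha, show a = 3 by omega]⟩
      · left; exact ⟨Finset.mem_powersetCard.2 hA, by rw [ha, show a = 4 by omega]⟩
    have h16 := card_rank_three_sixes_mul_sixteen_le hs hline hplane hXg
    rw [Finset.card_powersetCard] at hsplit
    have hr6 : r6 (F ∩ G).card + (F ∩ G).card.choose 3 / 16 ≤ (F ∩ G).card.choose 6 := by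
      unfold r6
      obtain ⟨h7, h10⟩ := hs7
      interval_cases h : (F ∩ G).card <;> decide
    have h16' : (((F ∩ G).powersetCard 6).filter (fun A : Finset α => M.eRk (A : Set α) = ((3 : ℕ) : ℕ∞))).card
        ≤ (F ∩ G).card.choose 3 / 16 := by
      rw [Nat.le_div_iff_mul_le (by norm_num)]
      linarith [h16]
    omega
  · have h0 : r6 (F ∩ G).card = 0 := by
      unfold r6
      split_ifs with h7 h8 h9 h10 <;> first | rfl | (exfalso; apply hs7; omega)
    rw [h0]
    exact Nat.zero_le _

/-- **(G-D) at `q = 6`, `j = 6`**: `Σ_m #Pc (n−6) m + Σ_s SP_{s,6} + Σ_s r₆(s)·NR 4 s + Σ_s C(s, 6)·NR 3 s ≤ C(n, 6)`. -/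
theorem gd6_row (hs : Simple M) (hline : ∀ L ∈ flatsQ M 2, L.card ≤ 3) (hplane : ∀ P ∈ flatsQ M 3, P.card ≤ 6)
    {G : Finset α} (hG : G ⊆ gr M) (hrG : M.eRk (G : Set α) = ((6 : ℕ) : ℕ∞)) (hn : 6 ≤ G.card) :
    ∑ m ∈ Finset.Icc (mTr M G) 6, (Pc M G 6 (G.card - 6) m).card
      + ∑ s ∈ Finset.range (G.card + 1), spSum M G 5 s 6
      + ∑ s ∈ Finset.range (G.card + 1), r6 s * NR M G 4 s
      + ∑ s ∈ Finset.range (G.card + 1), s.choose 6 * NR M G 3 s ≤ G.card.choose 6 := by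
  classical
  rw [choose_eq_sum_card_rank_subsets hrG 6]
  have hsplit : ∑ ρ ∈ Finset.range (6 + 1),
      ((G.powersetCard 6).filter (fun T : Finset α => M.eRk (T : Set α) = (ρ : ℕ∞))).card
      ≥ ((G.powersetCard 6).filter (fun T : Finset α => M.eRk (T : Set α) = ((6 : ℕ) : ℕ∞))).card
        + ((G.powersetCard 6).filter (fun T : Finset α => M.eRk (T : Set α) = ((5 : ℕ) : ℕ∞))).card
        + ((G.powersetCard 6).filter (fun T : Finset α => M.eRk (T : Set α) = ((4 : ℕ) : ℕ∞))).card
        + ((G.powersetCard 6).filter (fun T : Finset α => M.eRk (T : Set α) = ((3 : ℕ) : ℕ∞))).card := by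
    simp only [Finset.sum_range_succ, Finset.sum_range_zero]
    push_cast
    omega
  refine le_trans ?_ hsplit
  refine Nat.add_le_add (Nat.add_le_add (Nat.add_le_add ?_ ?_) ?_) ?_
  · rw [card_rank_q_subsets_eq_sum_Pc hG hrG hn]
  · rw [h2_row hG 5 6]
  · rw [card_rank_eq_eq_sum_flats hG 6 4]
    have hfib : ∑ s ∈ Finset.range (G.card + 1), r6 s * NR M G 4 s
        = ∑ F ∈ flatsQ M 4, r6 (F ∩ G).card := by
      unfold NR
      rw [← Finset.sum_fiberwise_of_maps_to (s := flatsQ M 4) (t := Finset.range (G.card + 1))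
        (g := fun F : Finset α => (F ∩ G).card) (fun F _ => Finset.mem_coe.2 (Finset.mem_range.2
          (Nat.lt_succ_of_le (Finset.card_le_card Finset.inter_subset_right))))]
      refine Finset.sum_congr rfl (fun s _ => ?_)
      rw [Finset.card_eq_sum_ones, Finset.mul_sum, mul_one]
      refine Finset.sum_congr rfl (fun F hF => ?_)
      rw [(Finset.mem_filter.1 hF).2]
    rw [hfib]
    exact Finset.sum_le_sum (fun F hF => card_rank_four_sixes_ge hs hline hplane hG hF)
  · rw [card_rank_eq_eq_sum_flats hG 6 3]
    have hfib : ∑ s ∈ Finset.range (G.card + 1), s.choose 6 * NR M G 3 s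
        = ∑ P ∈ flatsQ M 3, (P ∩ G).card.choose 6 := by
      unfold NR
      rw [← Finset.sum_fiberwise_of_maps_to (s := flatsQ M 3) (t := Finset.range (G.card + 1))
        (g := fun P : Finset α => (P ∩ G).card) (fun P _ => Finset.mem_coe.2 (Finset.mem_range.2
          (Nat.lt_succ_of_le (Finset.card_le_card Finset.inter_subset_right))))]
      refine Finset.sum_congr rfl (fun s _ => ?_)
      rw [Finset.card_eq_sum_ones, Finset.mul_sum, mul_one]
      refine Finset.sum_congr rfl (fun P hP => ?_)
      rw [(Finset.mem_filter.1 hP).2]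
    rw [hfib]
    refine Finset.sum_le_sum (fun P hP => ?_)
    rw [← Finset.card_powersetCard]
    refine le_of_eq ?_
    symm
    rw [Finset.card_filter_eq_iff]
    intro A hA
    rw [Finset.mem_powersetCard] at hA
    exact eRk_eq_three_of_six_subset_plane hs hline hG hP hA.1 hA.2

end PercRepro.Night4
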